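import Summits.Ventures.HodgeRepro2.T5SU11SphericalCfun

/-!
# The sharp `L^p` threshold of the spherical functions of `SU(1,1)`:
`φ_λ ∈ L^p(G)` **iff** `0 < λ < 2`, `p λ > 2` and `p (2 - λ) > 2`; `Ξ ∈ L^p` **iff** `p > 2`

The integrability half is `T5SU11SphericalLp`. For the divergence half the elementary lower bound
**`sph λ (a_t) ≥ e^{-λt}` for `λ ≥ 0`, `t ≥ 0`** (`exp_neg_mul_le_sph_hyp`: the Laplace integrand
`(cosh 2t - sinh 2t cos φ)^{-λ/2} ≥ (e^{2t})^{-λ/2}`) gives `|a(g)|^{-λ} ≤ 2^λ sph λ g` on the whole group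
(`norm_mat_inv_rpow_le_sph`), so that `sph λ ^ p` cannot be integrable when `p λ ≤ 2`
(`T5BergmanIntegrableSharp.integrable_norm_mat_inv_rpow_iff`: `|a(g)|^{-s} ∈ L¹` iff `s > 2`) —
`not_integrable_sph_rpow_of_mul_le`; by the functional equation the same holds when `p (2 - λ) ≤ 2`
(`not_integrable_sph_rpow_of_mul_le'`), and outside `(0, 2)` the spherical functions are `≥ 1`, hence never
integrable on the infinite-volume group (`not_integrable_sph_rpow_of_not_mem_Ioo`). Altogether, for
`p > 0`: **`sph λ ^ p ∈ L¹(G, μ)` iff `0 < λ < 2 ∧ 2 < p λ ∧ 2 < p (2 - λ)`** (`integrable_sph_rpow_iff`,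
`memLp_sph_iff`), and **`Ξ = sph 1 ∈ L^p(G)` iff `p > 2`** (`integrable_sph_one_rpow_iff`,
`memLp_sph_one_iff`) — Harish-Chandra's `Ξ ∈ L^{2+ε} ∖ L^2`. Nothing is claimed about (N).

Blind lane: Mathlib + the HodgeRepro2 prefix only; no sorry; axioms ⊆ {propext, Classical.choice,
Quot.sound}.
-/

namespace Summit.Ventures.HodgeRepro2.T5SU11SphericalLpSharp

open MeasureTheory MeasureTheory.Measure Metric Set Filter Topology Complex intervalIntegral
open T5SU11Unimodular T5SU11Fibration T5SU11Cartan T5SU11OneParameter T5SU11CartanProjection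
  T5HaarCircle T5BergmanCoefficient T5SU11SphericalFunction T5SU11SphericalTwo
  T5SU11SphericalSymmetry T5SU11SphericalBounds T5SU11SphericalContinuous
  T5SU11SphericalAsymptotic T5SU11SphericalLp T5SU11SphericalCfun T5BergmanIntegrableSharp
open scoped Real ENNReal

/-! ### The elementary lower bound `sph λ (a_t) ≥ e^{-λt}` -/

/-- `cosh 2t - sinh 2t cos φ ≤ e^{2t}` for `t ≥ 0`. -/
lemma laplace_base_le_exp {t : ℝ} (ht : 0 ≤ t) (φ : ℝ) :
    Real.cosh (2 * t) - Real.sinh (2 * t) * Real.cos φ ≤ Real.exp (2 * t) := by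
  have hs : 0 ≤ Real.sinh (2 * t) := Real.sinh_nonneg_iff.mpr (by linarith)
  have hc : -1 ≤ Real.cos φ := Real.neg_one_le_cos φ
  have h1 : Real.sinh (2 * t) * Real.cos φ ≥ -Real.sinh (2 * t) := by nlinarith
  have h2 : Real.cosh (2 * t) + Real.sinh (2 * t) = Real.exp (2 * t) := Real.cosh_add_sinh _
  linarith

/-- `(e^{2t})^{-λ/2} = e^{-λt}`. -/
lemma exp_two_mul_rpow (lam t : ℝ) : Real.exp (2 * t) ^ (-lam / 2) = Real.exp (-(lam * t)) := by
  rw [← Real.exp_mul]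
  congr 1
  ring

section measure

variable [MeasurableSpace Circle] [BorelSpace Circle]

/-- **`sph λ (a_t) ≥ e^{-λt}` for `λ ≥ 0` and `t ≥ 0`.** -/
theorem exp_neg_mul_le_sph_hyp {lam : ℝ} (hlam : 0 ≤ lam) {t : ℝ} (ht : 0 ≤ t) :
    Real.exp (-(lam * t)) ≤ sph lam (hyp t) := by
  have hπ := Real.pi_pos
  rw [sph_hyp_eq_laplace]
  have h : ∫ φ in (-π)..π, Real.exp (-(lam * t)) ≤
      ∫ φ in (-π)..π, (Real.cosh (2 * t) - Real.sinh (2 * t) * Real.cos φ) ^ (-lam / 2) := by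
    refine integral_mono_on (by linarith) intervalIntegrable_const ?_ fun φ _ => ?_
    · exact (Continuous.intervalIntegrable (by
        simp_rw [← gnorm_rpow_neg_eq]
        exact continuous_gnorm_rpow t (-lam)) _ _)
    · rw [← exp_two_mul_rpow]
      exact Real.rpow_le_rpow_of_nonpos (laplace_base_pos t φ) (laplace_base_le_exp ht φ)
        (by linarith)
  rw [intervalIntegral.integral_const, smul_eq_mul] at h
  calc Real.exp (-(lam * t)) = (2 * π)⁻¹ * ((π - -π) * Real.exp (-(lam * t))) := by
        rw [show π - -π = 2 * π by ring, ← mul_assoc, inv_mul_cancel₀ (by positivity), one_mul]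
    _ ≤ _ := mul_le_mul_of_nonneg_left h (by positivity)

/-- **`|a(g)|^{-λ} ≤ 2^λ sph λ g` on the whole group** for `λ ≥ 0`. -/
theorem norm_mat_inv_rpow_le_sph {lam : ℝ} (hlam : 0 ≤ lam) (g : SU11) :
    ‖mat g 0 0‖⁻¹ ^ lam ≤ 2 ^ lam * sph lam g := by
  have ht := cartanT_nonneg g
  have h1 := exp_neg_mul_le_sph_hyp hlam ht
  rw [← sph_eq_sph_hyp_cartanT] at h1
  -- `|a(g)|⁻¹ = cosh(cartanT g)⁻¹ ≤ 2 e^{-cartanT g}`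
  have h2 : ‖mat g 0 0‖⁻¹ ≤ 2 * Real.exp (-cartanT g) := by
    rw [← cosh_cartanT, Real.exp_neg]
    have hpos : 0 < Real.exp (cartanT g) := Real.exp_pos _
    have hc : Real.exp (cartanT g) / 2 ≤ Real.cosh (cartanT g) := by
      rw [Real.cosh_eq]
      linarith [(Real.exp_pos (-cartanT g)).le]
    calc (Real.cosh (cartanT g))⁻¹ ≤ (Real.exp (cartanT g) / 2)⁻¹ := inv_anti₀ (by positivity) hc
      _ = 2 * (Real.exp (cartanT g))⁻¹ := by rw [inv_div, div_eq_mul_inv]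
  calc ‖mat g 0 0‖⁻¹ ^ lam ≤ (2 * Real.exp (-cartanT g)) ^ lam :=
        Real.rpow_le_rpow (inv_nonneg.mpr (norm_nonneg _)) h2 hlam
    _ = 2 ^ lam * Real.exp (-(lam * cartanT g)) := by
        rw [Real.mul_rpow (by norm_num) (Real.exp_pos _).le, ← Real.exp_mul]
        congr 2
        ring
    _ ≤ 2 ^ lam * sph lam g := mul_le_mul_of_nonneg_left h1 (by positivity)

/-! ### The divergence half -/

/-- **`sph λ ^ p ∉ L¹(G, μ)` when `λ ≥ 0`, `p ≥ 0` and `p λ ≤ 2`**, against every Haar measure `μ`. -/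
theorem not_integrable_sph_rpow_of_mul_le (μ : Measure SU11) [IsHaarMeasure μ] {lam p : ℝ}
    (hlam : 0 ≤ lam) (hp0 : 0 ≤ p) (hp : p * lam ≤ 2) :
    ¬ Integrable (fun g => sph lam g ^ p) μ := by
  intro hint
  have hbad : Integrable (fun g => ‖mat g 0 0‖⁻¹ ^ (p * lam)) μ := by
    refine (hint.const_mul (2 ^ (p * lam))).mono' (continuous_norm_mat_inv_rpow _).aestronglyMeasurable
      (Filter.Eventually.of_forall fun g => ?_)
    have hinv : 0 ≤ ‖mat g 0 0‖⁻¹ := inv_nonneg.mpr (norm_nonneg _)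
    rw [Real.norm_eq_abs, abs_of_nonneg (Real.rpow_nonneg hinv _), mul_comm p lam,
      Real.rpow_mul hinv, Real.rpow_mul (by norm_num : (0 : ℝ) ≤ 2), ← Real.mul_rpow (by positivity)
      (sph_pos lam g).le]
    exact Real.rpow_le_rpow (Real.rpow_nonneg hinv _) (norm_mat_inv_rpow_le_sph hlam g) hp0
  have := (integrable_norm_mat_inv_rpow_iff μ (p * lam)).mp hbad
  linarith

/-- **`sph λ ^ p ∉ L¹(G, μ)` when `λ ≤ 2`, `p ≥ 0` and `p (2 - λ) ≤ 2`** (the functional equation). -/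
theorem not_integrable_sph_rpow_of_mul_le' (μ : Measure SU11) [IsHaarMeasure μ] {lam p : ℝ}
    (hlam : lam ≤ 2) (hp0 : 0 ≤ p) (hp : p * (2 - lam) ≤ 2) :
    ¬ Integrable (fun g => sph lam g ^ p) μ := by
  have := not_integrable_sph_rpow_of_mul_le μ (lam := 2 - lam) (by linarith) hp0 hp
  simpa only [← sph_two_sub lam] using this

/-- **`sph λ ^ p ∉ L¹(G, μ)` for `λ ∉ (0, 2)` and `p ≥ 0`**: the function is `≥ 1` on the
infinite-volume group. -/
theorem not_integrable_sph_rpow_of_not_mem_Ioo (μ : Measure SU11) [IsHaarMeasure μ] {lam p : ℝ}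
    (hlam : lam ≤ 0 ∨ 2 ≤ lam) (hp0 : 0 ≤ p) : ¬ Integrable (fun g => sph lam g ^ p) μ := by
  intro hint
  have hbad : Integrable (fun g => ‖mat g 0 0‖⁻¹ ^ (2 : ℝ)) μ := by
    refine hint.mono' (continuous_norm_mat_inv_rpow _).aestronglyMeasurable
      (Filter.Eventually.of_forall fun g => ?_)
    have hinv : 0 ≤ ‖mat g 0 0‖⁻¹ := inv_nonneg.mpr (norm_nonneg _)
    rw [Real.norm_eq_abs, abs_of_nonneg (Real.rpow_nonneg hinv _)]
    have h1 : ‖mat g 0 0‖⁻¹ ≤ 1 := by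
      rw [← cosh_cartanT]
      exact inv_le_one_of_one_le₀ (Real.one_le_cosh _)
    calc ‖mat g 0 0‖⁻¹ ^ (2 : ℝ) ≤ 1 := Real.rpow_le_one hinv h1 (by norm_num)
      _ ≤ sph lam g ^ p :=
          le_trans (le_of_eq (Real.one_rpow p).symm)
            (Real.rpow_le_rpow zero_le_one (one_le_sph hlam g) hp0)
  have := (integrable_norm_mat_inv_rpow_iff μ 2).mp hbad
  linarith

/-! ### The sharp thresholds -/

/-- **THE `L^p` THRESHOLD OF THE REAL SPHERICAL FUNCTIONS**: for `p > 0` and every Haar measure `μ`,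
`sph λ ^ p ∈ L¹(SU(1,1), μ)` iff `0 < λ < 2`, `p λ > 2` and `p (2 - λ) > 2`. -/
theorem integrable_sph_rpow_iff (μ : Measure SU11) [IsHaarMeasure μ] {lam p : ℝ} (hp0 : 0 < p) :
    Integrable (fun g => sph lam g ^ p) μ ↔ 0 < lam ∧ lam < 2 ∧ 2 < p * lam ∧ 2 < p * (2 - lam) := by
  constructor
  · intro hint
    have h0 : 0 < lam := by
      by_contra h
      exact not_integrable_sph_rpow_of_not_mem_Ioo μ (Or.inl (not_lt.mp h)) hp0.le hint
    have h2 : lam < 2 := by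
      by_contra h
      exact not_integrable_sph_rpow_of_not_mem_Ioo μ (Or.inr (not_lt.mp h)) hp0.le hint
    have hp1 : 2 < p * lam := by
      by_contra h
      exact not_integrable_sph_rpow_of_mul_le μ h0.le hp0.le (not_lt.mp h) hint
    have hp2 : 2 < p * (2 - lam) := by
      by_contra h
      exact not_integrable_sph_rpow_of_mul_le' μ h2.le hp0.le (not_lt.mp h) hint
    exact ⟨h0, h2, hp1, hp2⟩
  · rintro ⟨h0, h2, hp1, hp2⟩
    exact integrable_sph_rpow_of_mem_Ioo μ h0 h2 hp1 hp2

/-- **`Ξ = sph 1 ∈ L^p` iff `p > 2`** (`p > 0`): Harish-Chandra's `Ξ ∈ L^{2+ε} ∖ L²`. -/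
theorem integrable_sph_one_rpow_iff (μ : Measure SU11) [IsHaarMeasure μ] {p : ℝ} (hp0 : 0 < p) :
    Integrable (fun g => sph 1 g ^ p) μ ↔ 2 < p := by
  rw [integrable_sph_rpow_iff μ hp0]
  constructor
  · rintro ⟨-, -, h, -⟩
    linarith
  · intro h
    exact ⟨zero_lt_one, one_lt_two, by linarith, by linarith⟩

/-- **`MemLp (sph λ) p μ` iff `0 < λ < 2`, `p λ > 2` and `p (2 - λ) > 2`** (`p > 0`). -/
theorem memLp_sph_iff (μ : Measure SU11) [IsHaarMeasure μ] {lam p : ℝ} (hp0 : 0 < p) :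
    MemLp (sph lam) (ENNReal.ofReal p) μ ↔ 0 < lam ∧ lam < 2 ∧ 2 < p * lam ∧ 2 < p * (2 - lam) := by
  rw [← integrable_norm_rpow_iff (continuous_sph lam).aestronglyMeasurable (by simp [hp0])
    ENNReal.ofReal_ne_top, ENNReal.toReal_ofReal hp0.le]
  have e : (fun g : SU11 => ‖sph lam g‖ ^ p) = fun g => sph lam g ^ p := by
    funext g
    rw [Real.norm_eq_abs, abs_of_nonneg (sph_pos lam g).le]
  rw [e]
  exact integrable_sph_rpow_iff μ hp0

/-- **`MemLp (sph 1) p μ` iff `p > 2`** (`p > 0`): Harish-Chandra's `Ξ` lies in `L^p(SU(1,1))` exactly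
for `p > 2`. -/
theorem memLp_sph_one_iff (μ : Measure SU11) [IsHaarMeasure μ] {p : ℝ} (hp0 : 0 < p) :
    MemLp (sph 1) (ENNReal.ofReal p) μ ↔ 2 < p := by
  rw [memLp_sph_iff μ hp0]
  constructor
  · rintro ⟨-, -, h, -⟩
    linarith
  · intro h
    exact ⟨zero_lt_one, one_lt_two, by linarith, by linarith⟩

end measure

end Summit.Ventures.HodgeRepro2.T5SU11SphericalLpSharp
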